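import Mathlib
import HarnessLib
import Summits.AtomisticToContinuum.Crystallization.Theorems.OverbindingBudgetShellHoleGaps
import Summits.AtomisticToContinuum.Crystallization.Theorems.PricedLinkCensusSoftFourRingsCapFacetKinds

/-!
# Shell-hole cover II — the facet level bound

For the hull setting of the twelve-point reduction (twelve unit directions `X`, pairwise
`⟪u, u'⟫ ≤ cₐ`, `24` bonded pairs `B` with `⟪u, u'⟫ ≥ c_b`, four at each direction, covering
radius `< 0.957`) every facet normal `c` of `conv X` satisfies `c_b ≤ ‖c‖⁻²`
(`facet_level_bound`): the facet circle has angular radius `≤ arccos √c_b < 45.6°`.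

Proof.  By `Cap.facet_kinds_of_no_slack` a facet is a bond quadrilateral, a bond triangle or a
triangle with exactly one non-bond hull edge.  Order its vertices by signed azimuth
(`facetVertex`); consecutive vertices span its hull edges (`edgesOfFacet_eq_image`).  If
`‖c‖⁻² < c_b`, bond gaps are `< π/2` and all gaps are `> π/4` (file I), so an all-bond facet has
total gap `< 2π` — absurd.  In the remaining case the second facet through the non-bond edge
`{p, q}` (`card_facetsOfEdge = 2`) is a triangle `{p, q, z}` whose edges at `z` are bonds
(`second_facet`), and `no_bbd` gives `⟪z, apex⟫ > cₐ`, contradicting separation.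
-/

namespace Summit.AtomisticToContinuum.Crystallization.Theorems.OverbindingBudgetShellHoleFacets

open Real RealInnerProductSpace Literature.Geometry.DiscreteGeometry OverbindingBudgetShellHoleGaps

/-- `{a, b} = {c, d}` iff the pairs agree up to order. -/
theorem pair_eq_pair_iff {a b c d : EuclideanSpace ℝ (Fin 3)} :
    ({a, b} : Finset (EuclideanSpace ℝ (Fin 3))) = {c, d} ↔ (a = c ∧ b = d) ∨ (a = d ∧ b = c) := by
  rw [← Finset.coe_inj, Finset.coe_pair, Finset.coe_pair, Set.pair_eq_pair_iff]

open scoped Classical in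
/-- **The second facet through a non-bond hull edge.**  If the facet of `c` is a triangle
`{p, q, r}` whose hull edge `{p, q}` is not a bond, the other facet through `{p, q}` is a
triangle `{p, q, z}` with `z ≠ r` and `{p, z}, {q, z}` bonds. -/
theorem second_facet {X : Finset (EuclideanSpace ℝ (Fin 3))} {B : Finset (Finset (EuclideanSpace ℝ (Fin 3)))}
    (hT : ∀ p : EuclideanSpace ℝ (Fin 3), ‖p‖ = 1 → ∃ x ∈ X, dist p x < 0.957)
    (hX1 : ∀ y ∈ X, ‖y‖ = 1) (hcard : X.card = 12)
    (hsepX : ∀ u ∈ X, ∀ u' ∈ X, u ≠ u' → ⟪u, u'⟫ ≤ 1 - 1 / (2 * (101 / 100 : ℝ) ^ 2))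
    (hB : ∀ T ∈ B, ∃ u ∈ X, ∃ u' ∈ X, u ≠ u' ∧ 1 - (101 / 100 : ℝ) ^ 2 / 2 ≤ ⟪u, u'⟫ ∧
      T = {u, u'})
    (hBcard : B.card = 24)
    (hdeg : ∀ v ∈ X, ∃ w : Fin 4 → EuclideanSpace ℝ (Fin 3), (∀ k, w k ∈ X) ∧ Function.Injective w ∧
      (∀ k, w k ≠ v) ∧ (∀ k, ({v, w k} : Finset (EuclideanSpace ℝ (Fin 3))) ∈ B) ∧
      ∀ y, ({v, y} : Finset (EuclideanSpace ℝ (Fin 3))) ∈ B → ∃ k, y = w k)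
    (h0 : (0 : EuclideanSpace ℝ (Fin 3)) ∈ interior (convexHull ℝ (X : Set (EuclideanSpace ℝ (Fin 3)))))
    {c : EuclideanSpace ℝ (Fin 3)} (_hcF : c ∈ facetNormals X) (h3c : (tightSet X c).card = 3) {p q r : EuclideanSpace ℝ (Fin 3)}
    (hpq : p ≠ q) (htight : tightSet X c ⊆ {p, q, r})
    (hE : ({p, q} : Finset (EuclideanSpace ℝ (Fin 3))) ∈ edgesOfFacet X c) (hnb : ({p, q} : Finset (EuclideanSpace ℝ (Fin 3))) ∉ B) :
    ∃ z ∈ X, z ≠ r ∧ ({p, z} : Finset (EuclideanSpace ℝ (Fin 3))) ∈ B ∧ ({q, z} : Finset (EuclideanSpace ℝ (Fin 3))) ∈ B := by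
  have hEf := Finset.mem_filter.1 hE
  have hEh : ({p, q} : Finset (EuclideanSpace ℝ (Fin 3))) ∈ hullEdges X := hEf.1
  have h2 := card_facetsOfEdge hX1 h0 hEh
  obtain ⟨c', hc'mem, hc'ne⟩ := Finset.exists_mem_ne (s := facetsOfEdge X {p, q})
    (by rw [h2]; norm_num) c
  have hc'f := Finset.mem_filter.1 hc'mem
  have hc'F : c' ∈ facetNormals X := hc'f.1
  have hsub' : ({p, q} : Finset (EuclideanSpace ℝ (Fin 3))) ⊆ tightSet X c' := hc'f.2
  have hE' : ({p, q} : Finset (EuclideanSpace ℝ (Fin 3))) ∈ edgesOfFacet X c' := by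
    unfold edgesOfFacet; rw [Finset.mem_filter]; exact ⟨hEh, hsub'⟩
  -- `c'` is a triangle with at most one non-bond edge, namely `{p, q}`
  have hkind' := Cap.facet_kinds_of_no_slack hT hX1 hcard hsepX hB hBcard hdeg c' hc'F
  have h3' : (tightSet X c').card = 3 ∧
      ((edgesOfFacet X c').filter (fun T => T ∉ B)).card ≤ 1 := by
    rcases hkind' with h | ⟨-, h0'⟩
    · exact h
    · exfalso
      have hpos : 0 < ((edgesOfFacet X c').filter (fun T => T ∉ B)).card :=
        Finset.card_pos.2 ⟨{p, q}, by rw [Finset.mem_filter]; exact ⟨hE', hnb⟩⟩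
      omega
  obtain ⟨h3, hle1⟩ := h3'
  -- every pair of tight points of `c'` is an edge
  have hedges' : edgesOfFacet X c' = (tightSet X c').powersetCard 2 := by
    apply Finset.eq_of_subset_of_card_le
    · intro T hT'
      have hT'f := Finset.mem_filter.1 hT'
      exact Finset.mem_powersetCard.2 ⟨hT'f.2, card_eq_two_of_mem_hullEdges hT'f.1⟩
    · rw [Finset.card_powersetCard, h3, card_edgesOfFacet hX1 h0 hc'F, h3]
      decide
  -- the third vertex `z`
  have hlt : ({p, q} : Finset (EuclideanSpace ℝ (Fin 3))).card < (tightSet X c').card := by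
    rw [Finset.card_pair hpq, h3]; norm_num
  obtain ⟨z, hz, hzpq⟩ := Finset.exists_mem_notMem_of_card_lt_card hlt
  have hzp : z ≠ p := fun h => hzpq (by rw [h]; exact Finset.mem_insert_self _ _)
  have hzq : z ≠ q := fun h =>
    hzpq (by rw [h]; exact Finset.mem_insert_of_mem (Finset.mem_singleton_self _))
  have hzX : z ∈ X := tightSet_subset X c' hz
  have hpt : p ∈ tightSet X c' := hsub' (Finset.mem_insert_self _ _)
  have hqt : q ∈ tightSet X c' := hsub' (Finset.mem_insert_of_mem (Finset.mem_singleton_self _))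
  have hbond : ∀ y ∈ tightSet X c', y ≠ z → ({y, z} : Finset (EuclideanSpace ℝ (Fin 3))) ∈ B := by
    intro y hy hyz
    have hedge : ({y, z} : Finset (EuclideanSpace ℝ (Fin 3))) ∈ edgesOfFacet X c' := by
      rw [hedges', Finset.mem_powersetCard]
      refine ⟨?_, Finset.card_pair hyz⟩
      intro x hx
      rw [Finset.mem_insert, Finset.mem_singleton] at hx
      rcases hx with rfl | rfl
      · exact hy
      · exact hz
    by_contra hnB
    have heq := Finset.card_le_one.1 hle1 {y, z} (by rw [Finset.mem_filter]; exact ⟨hedge, hnB⟩)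
      {p, q} (by rw [Finset.mem_filter]; exact ⟨hE', hnb⟩)
    have : z ∈ ({p, q} : Finset (EuclideanSpace ℝ (Fin 3))) := by
      rw [← heq]; exact Finset.mem_insert_of_mem (Finset.mem_singleton_self _)
    exact hzpq this
  refine ⟨z, hzX, ?_, hbond p hpt hzp.symm, hbond q hqt hzq.symm⟩
  -- `z ≠ r`: otherwise the two facets have the same tight set
  intro hzr
  apply hc'ne
  have hsub : tightSet X c ⊆ tightSet X c' := by
    intro x hx
    have hx' := htight hx
    rw [Finset.mem_insert, Finset.mem_insert, Finset.mem_singleton] at hx'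
    rcases hx' with rfl | rfl | rfl
    · exact hpt
    · exact hqt
    · rw [← hzr]; exact hz
  have hceq : tightSet X c = tightSet X c' :=
    Finset.eq_of_subset_of_card_le hsub (by rw [h3, h3c])
  exact (mem_facetNormals.1 hc'F).eq_of_tightSet_eq hceq.symm

open scoped Classical in
/-- **The facet level bound**: every facet normal `c` of the twelve-point hull has
`c_b ≤ ‖c‖⁻²`, `c_b = 1 − 1.01²/2` — the facet circle has angular radius `≤ arccos √c_b`. -/
theorem facet_level_bound {X : Finset (EuclideanSpace ℝ (Fin 3))} {B : Finset (Finset (EuclideanSpace ℝ (Fin 3)))}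
    (hT : ∀ p : EuclideanSpace ℝ (Fin 3), ‖p‖ = 1 → ∃ x ∈ X, dist p x < 0.957)
    (hX1 : ∀ y ∈ X, ‖y‖ = 1) (hcard : X.card = 12)
    (hsepX : ∀ u ∈ X, ∀ u' ∈ X, u ≠ u' → ⟪u, u'⟫ ≤ 1 - 1 / (2 * (101 / 100 : ℝ) ^ 2))
    (hB : ∀ T ∈ B, ∃ u ∈ X, ∃ u' ∈ X, u ≠ u' ∧ 1 - (101 / 100 : ℝ) ^ 2 / 2 ≤ ⟪u, u'⟫ ∧
      T = {u, u'})
    (hBcard : B.card = 24)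
    (hdeg : ∀ v ∈ X, ∃ w : Fin 4 → EuclideanSpace ℝ (Fin 3), (∀ k, w k ∈ X) ∧ Function.Injective w ∧
      (∀ k, w k ≠ v) ∧ (∀ k, ({v, w k} : Finset (EuclideanSpace ℝ (Fin 3))) ∈ B) ∧
      ∀ y, ({v, y} : Finset (EuclideanSpace ℝ (Fin 3))) ∈ B → ∃ k, y = w k) :
    ∀ c ∈ facetNormals X, 1 - (101 / 100 : ℝ) ^ 2 / 2 ≤ ‖c‖⁻¹ ^ 2 := by
  intro c hcF
  by_contra hlt
  push Not at hlt
  have hc0 : c ≠ 0 := ne_zero_of_mem_facetNormals hX1 hcF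
  have hcF' := mem_facetNormals.1 hcF
  have h0 : (0 : EuclideanSpace ℝ (Fin 3)) ∈ interior (convexHull ℝ (X : Set (EuclideanSpace ℝ (Fin 3)))) :=
    Cap.zero_mem_interior_convexHull_of_twelve_le_card hT hX1 hcard.ge
      (ca := 1 - 1 / (2 * (101 / 100 : ℝ) ^ 2)) (by norm_num) hsepX
  -- the level `κ = ‖c‖⁻¹`
  set κ := ‖c‖⁻¹ with hκ
  have hcn1 : 1 < ‖c‖ := one_lt_norm_of_mem_facetNormals hX1 hcF
  have hcn : 0 < ‖c‖ := by linarith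
  have hκ0 : 0 < κ := inv_pos.2 hcn
  have hκ1 : κ < 1 := inv_lt_one_of_one_lt₀ hcn1
  have hsep' : ∀ u ∈ X, ∀ v ∈ X, u ≠ v → (0.957 : ℝ) ≤ dist u v := by
    intro u hu v hv huv
    have hd : dist u v ^ 2 = 2 - 2 * ⟪u, v⟫ := by
      rw [dist_eq_norm, ← real_inner_self_eq_norm_sq, inner_sub_left, inner_sub_right,
        inner_sub_right, real_inner_self_eq_norm_sq, real_inner_self_eq_norm_sq, hX1 u hu,
        hX1 v hv, real_inner_comm u v]
      ring
    have h := hsepX u hu v hv huv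
    have h2 : (0.957 : ℝ) ^ 2 ≤ dist u v ^ 2 := by rw [hd]; norm_num at h ⊢; linarith
    exact (pow_le_pow_iff_left₀ (by norm_num) dist_nonneg two_ne_zero).1 h2
  have hnc : ‖c‖ < 2 / (2 - 0.957 ^ 2) :=
    Cap.norm_lt_of_forall_inner_le_one hT hX1 hcard.ge hsep' hcF'.1
  have hκlo : 0.2938 ≤ κ ^ 2 := by
    have hκgt : (2 - 0.957 ^ 2) / 2 < κ := by
      rw [hκ, lt_inv_comm₀ (by norm_num) hcn, inv_div]; exact hnc
    nlinarith
  set ρ := Real.sqrt (1 - κ ^ 2) with hρ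
  have hρ2 : ρ ^ 2 = 1 - κ ^ 2 := Real.sq_sqrt (by nlinarith)
  have hρρ : Real.sqrt (1 - κ ^ 2) * Real.sqrt (1 - κ ^ 2) = ρ ^ 2 := by rw [hρ]; exact (sq _).symm
  -- the vertices of the facet in counter-clockwise order
  have hm : (facetAngles X c hc0).card = (tightSet X c).card := card_facetAngles hX1 hc0
  set w := facetVertex X c hc0 with hw
  set φ : ℕ → ℝ := fun j => signedAzimuth c hc0 (w j) with hφ
  have hwt : ∀ j, j < (tightSet X c).card → w j ∈ tightSet X c := fun j hj =>
    facetVertex_mem hc0 (hm ▸ hj)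
  have hwX : ∀ j, j < (tightSet X c).card → w j ∈ X := fun j hj =>
    tightSet_subset X c (hwt j hj)
  have hw1 : ∀ j, j < (tightSet X c).card → ‖w j‖ = 1 := fun j hj => hX1 _ (hwX j hj)
  have hwc : ∀ j, j < (tightSet X c).card → ⟪c, w j⟫ = 1 := fun j hj =>
    (mem_tightSet.1 (hwt j hj)).2
  have hwax : ∀ j, j < (tightSet X c).card → ⟪facetAxis c, w j⟫ = κ := fun j hj =>
    inner_facetAxis_of_tight (hwc j hj)
  have hwne : ∀ i j, i < (tightSet X c).card → j < (tightSet X c).card → i ≠ j → w i ≠ w j :=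
    fun i j hi hj hij h => hij (facetVertex_injOn hc0
      (Finset.mem_coe.2 (Finset.mem_range.2 (hm ▸ hi)))
      (Finset.mem_coe.2 (Finset.mem_range.2 (hm ▸ hj))) h)
  have hφlt : ∀ i j, i < j → j < (tightSet X c).card → φ i < φ j := fun i j hij hj =>
    signedAzimuth_facetVertex_lt hc0 hij (hm ▸ hj)
  have hφ2π : ∀ i j, φ i - φ j < 2 * π := fun i j => signedAzimuth_sub_lt c hc0 _ _
  have hinner : ∀ i j, i < (tightSet X c).card → j < (tightSet X c).card →
      ⟪w i, w j⟫ = ρ ^ 2 * Real.cos (φ i - φ j) + κ ^ 2 := by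
    intro i j hi hj
    rw [inner_eq_of_levels_signed hc0 (hw1 i hi) (hw1 j hj) (hwax i hi) (hwax j hj), hρρ, sq κ]
  have hsepw : ∀ i j, i < (tightSet X c).card → j < (tightSet X c).card → i ≠ j →
      ρ ^ 2 * Real.cos (φ j - φ i) + κ ^ 2 ≤ 1 - 1 / (2 * (101 / 100 : ℝ) ^ 2) := by
    intro i j hi hj hij
    rw [cos_sub_rev, ← hinner i j hi hj]
    exact hsepX _ (hwX i hi) _ (hwX j hj) (hwne i j hi hj hij)
  have hbond_pair : ∀ a b : EuclideanSpace ℝ (Fin 3), ({a, b} : Finset (EuclideanSpace ℝ (Fin 3))) ∈ B →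
      1 - (101 / 100 : ℝ) ^ 2 / 2 ≤ ⟪a, b⟫ := by
    intro a b hab
    obtain ⟨u, -, u', -, -, hb, hTeq⟩ := hB _ hab
    rcases pair_eq_pair_iff.1 hTeq with ⟨h1, h2⟩ | ⟨h1, h2⟩
    · rw [h1, h2]; exact hb
    · rw [h1, h2, real_inner_comm]; exact hb
  have hbondw : ∀ i j, i < (tightSet X c).card → j < (tightSet X c).card →
      ({w i, w j} : Finset (EuclideanSpace ℝ (Fin 3))) ∈ B →
      1 - (101 / 100 : ℝ) ^ 2 / 2 ≤ ρ ^ 2 * Real.cos (φ j - φ i) + κ ^ 2 := by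
    intro i j hi hj hmem
    rw [cos_sub_rev, ← hinner i j hi hj]
    exact hbond_pair _ _ hmem
  have hkind := Cap.facet_kinds_of_no_slack hT hX1 hcard hsepX hB hBcard hdeg c hcF
  have hedges := edgesOfFacet_eq_image hX1 h0 hcF
  rcases hkind with ⟨hm3, hfilt⟩ | ⟨hm4, hfilt⟩
  · ----------------------------------------------------------------- triangles
    have hm3' : (facetAngles X c hc0).card = 3 := by rw [hm, hm3]
    rw [hm3'] at hedges
    have hedge : ∀ j < 3, ({w j, w ((j + 1) % 3)} : Finset (EuclideanSpace ℝ (Fin 3))) ∈ edgesOfFacet X c := by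
      intro j hj; rw [hedges]; exact Finset.mem_image.2 ⟨j, Finset.mem_range.2 hj, rfl⟩
    have l0 : 0 < (tightSet X c).card := by omega
    have l1 : 1 < (tightSet X c).card := by omega
    have l2 : 2 < (tightSet X c).card := by omega
    -- the three gaps
    have hg0 := gap_window (g := φ 1 - φ 0) hρ2 (by linarith [hφlt 0 1 zero_lt_one l1])
      (hφ2π 1 0) (hsepw 0 1 l0 l1 (by norm_num))
    have hg1 := gap_window (g := φ 2 - φ 1) hρ2 (by linarith [hφlt 1 2 one_lt_two l2])
      (hφ2π 2 1) (hsepw 1 2 l1 l2 (by norm_num))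
    have hsep20 : ρ ^ 2 * Real.cos (2 * π - (φ 2 - φ 0)) + κ ^ 2 ≤
        1 - 1 / (2 * (101 / 100 : ℝ) ^ 2) := by
      rw [Real.cos_two_pi_sub]; exact hsepw 0 2 l0 l2 (by norm_num)
    have hg2 := gap_window (g := 2 * π - (φ 2 - φ 0)) hρ2 (by linarith [hφ2π 2 0])
      (by linarith [hφlt 0 2 (by norm_num) l2]) hsep20
    -- bond edges give short gaps
    have hb0 : ({w 0, w 1} : Finset (EuclideanSpace ℝ (Fin 3))) ∈ B → φ 1 - φ 0 < π / 2 ∨ 3 * π / 2 < φ 1 - φ 0 :=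
      fun h => bond_gap hlt (hbondw 0 1 l0 l1 h)
    have hb1 : ({w 1, w 2} : Finset (EuclideanSpace ℝ (Fin 3))) ∈ B → φ 2 - φ 1 < π / 2 ∨ 3 * π / 2 < φ 2 - φ 1 :=
      fun h => bond_gap hlt (hbondw 1 2 l1 l2 h)
    have hb2 : ({w 2, w 0} : Finset (EuclideanSpace ℝ (Fin 3))) ∈ B →
        2 * π - (φ 2 - φ 0) < π / 2 ∨ 3 * π / 2 < 2 * π - (φ 2 - φ 0) := by
      intro h
      have h' := hbond_pair _ _ h
      rw [hinner 2 0 l2 l0] at h'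
      rw [← Real.cos_two_pi_sub] at h'
      exact bond_gap hlt h'
    have hsum : (φ 1 - φ 0) + (φ 2 - φ 1) + (2 * π - (φ 2 - φ 0)) = 2 * π := by ring
    have e0 := hedge 0 (by norm_num)
    have e1 := hedge 1 (by norm_num)
    have e2 := hedge 2 (by norm_num)
    simp only [Nat.reduceAdd, Nat.reduceMod] at e0 e1 e2
    -- pairwise distinct vertices, the tight set
    have h01 : w 0 ≠ w 1 := hwne 0 1 l0 l1 (by norm_num)
    have h02 : w 0 ≠ w 2 := hwne 0 2 l0 l2 (by norm_num)
    have h12 : w 1 ≠ w 2 := hwne 1 2 l1 l2 (by norm_num)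
    have htight0 : tightSet X c = {w 0, w 1, w 2} := by
      rw [← image_range_facetVertex hX1 hc0, hm3', show Finset.range 3 = {0, 1, 2} by decide]
      simp only [Finset.image_insert, Finset.image_singleton, hw]
    have hperm : ∀ x ∈ tightSet X c, x = w 0 ∨ x = w 1 ∨ x = w 2 := by
      intro x hx
      rw [htight0] at hx
      simpa only [Finset.mem_insert, Finset.mem_singleton] using hx
    have hsub201 : tightSet X c ⊆ {w 2, w 0, w 1} := fun x hx => by
      rcases hperm x hx with h | h | h <;> rw [h] <;> simp
    have hsub120 : tightSet X c ⊆ {w 1, w 2, w 0} := fun x hx => by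
      rcases hperm x hx with h | h | h <;> rw [h] <;> simp
    have hsub012 : tightSet X c ⊆ {w 0, w 1, w 2} := fun x hx => by
      rcases hperm x hx with h | h | h <;> rw [h] <;> simp
    have hcz : ∀ z ∈ X, ⟪c, z⟫ ≤ 1 := hcF'.1
    -- which edges are bonds?
    by_cases hB0 : ({w 0, w 1} : Finset (EuclideanSpace ℝ (Fin 3))) ∈ B <;> by_cases hB1 : ({w 1, w 2} : Finset (EuclideanSpace ℝ (Fin 3))) ∈ B <;>
      by_cases hB2 : ({w 2, w 0} : Finset (EuclideanSpace ℝ (Fin 3))) ∈ B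
    · -- all three edges bonded: total gap `< 2π`
      exact three_gaps_false hsum hg0.1 hg1.1 hg2.1 (hb0 hB0) (hb1 hB1) (hb2 hB2)
    · -- non-bond edge `{w 2, w 0}`: apex `w 1`, `u = w 0`, `w = w 2`
      obtain ⟨ha, hb⟩ := two_bond_gaps hsum hg0.1 hg1.1 hg2.1 (hb0 hB0) (hb1 hB1)
      obtain ⟨z, hzX, hz1, hz2, hz0⟩ := second_facet hT hX1 hcard hsepX hB hBcard hdeg h0 hcF hm3
        h02.symm hsub201
        e2 hB2
      have hlt' := no_bbd hc0 hκlo hlt (hw1 0 l0) (hw1 1 l1) (hw1 2 l2) (hX1 z hzX) (hwc 0 l0)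
        (hwc 1 l1) (hwc 2 l2) (hcz z hzX) (a := φ 1 - φ 0) (b := φ 2 - φ 1)
        (by linarith [hφlt 0 1 zero_lt_one l1]) ha (by linarith [hφlt 1 2 one_lt_two l2]) hb
        (Or.inl (by simp only [hφ])) (Or.inl (by simp only [hφ]))
        (hsepX _ (hwX 0 l0) _ (hwX 1 l1) h01) (hsepX _ (hwX 2 l2) _ (hwX 1 l1) h12.symm)
        (by rw [real_inner_comm]; exact hbond_pair _ _ hz0)
        (by rw [real_inner_comm]; exact hbond_pair _ _ hz2)
      exact absurd (hsepX z hzX _ (hwX 1 l1) hz1) (not_le.2 hlt')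
    · -- non-bond edge `{w 1, w 2}`: apex `w 0`, `u = w 2`, `w = w 1`
      obtain ⟨ha, hb⟩ := two_bond_gaps (by linarith [hsum]) hg2.1 hg0.1 hg1.1 (hb2 hB2) (hb0 hB0)
      obtain ⟨z, hzX, hz0, hz1, hz2⟩ := second_facet hT hX1 hcard hsepX hB hBcard hdeg h0 hcF hm3
        h12 hsub120
        e1 hB1
      have hlt' := no_bbd hc0 hκlo hlt (hw1 2 l2) (hw1 0 l0) (hw1 1 l1) (hX1 z hzX) (hwc 2 l2)
        (hwc 0 l0) (hwc 1 l1) (hcz z hzX) (a := 2 * π - (φ 2 - φ 0)) (b := φ 1 - φ 0)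
        (by linarith [hφ2π 2 0]) ha (by linarith [hφlt 0 1 zero_lt_one l1]) hb
        (Or.inr (by simp only [hφ]; ring)) (Or.inl (by simp only [hφ]))
        (hsepX _ (hwX 2 l2) _ (hwX 0 l0) h02.symm) (hsepX _ (hwX 1 l1) _ (hwX 0 l0) h01.symm)
        (by rw [real_inner_comm]; exact hbond_pair _ _ hz2)
        (by rw [real_inner_comm]; exact hbond_pair _ _ hz1)
      exact absurd (hsepX z hzX _ (hwX 0 l0) hz0) (not_le.2 hlt')
    · -- two non-bond edges `{w 1, w 2}`, `{w 2, w 0}`: impossible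
      have heq := Finset.card_le_one.1 hfilt {w 1, w 2} (by rw [Finset.mem_filter]; exact ⟨e1, hB1⟩)
        {w 2, w 0} (by rw [Finset.mem_filter]; exact ⟨e2, hB2⟩)
      exact absurd heq (pair_ne_of_ne_left h12 h01.symm)
    · -- non-bond edge `{w 0, w 1}`: apex `w 2`, `u = w 1`, `w = w 0`
      obtain ⟨ha, hb⟩ := two_bond_gaps (by linarith [hsum]) hg1.1 hg2.1 hg0.1 (hb1 hB1) (hb2 hB2)
      obtain ⟨z, hzX, hz2, hz0, hz1⟩ := second_facet hT hX1 hcard hsepX hB hBcard hdeg h0 hcF hm3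
        h01 hsub012
        e0 hB0
      have hlt' := no_bbd hc0 hκlo hlt (hw1 1 l1) (hw1 2 l2) (hw1 0 l0) (hX1 z hzX) (hwc 1 l1)
        (hwc 2 l2) (hwc 0 l0) (hcz z hzX) (a := φ 2 - φ 1) (b := 2 * π - (φ 2 - φ 0))
        (by linarith [hφlt 1 2 one_lt_two l2]) ha (by linarith [hφ2π 2 0]) hb
        (Or.inl (by simp only [hφ])) (Or.inr (by simp only [hφ]; ring))
        (hsepX _ (hwX 1 l1) _ (hwX 2 l2) h12) (hsepX _ (hwX 0 l0) _ (hwX 2 l2) h02)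
        (by rw [real_inner_comm]; exact hbond_pair _ _ hz1)
        (by rw [real_inner_comm]; exact hbond_pair _ _ hz0)
      exact absurd (hsepX z hzX _ (hwX 2 l2) hz2) (not_le.2 hlt')
    · -- two non-bond edges `{w 0, w 1}`, `{w 2, w 0}`
      have heq := Finset.card_le_one.1 hfilt {w 0, w 1} (by rw [Finset.mem_filter]; exact ⟨e0, hB0⟩)
        {w 2, w 0} (by rw [Finset.mem_filter]; exact ⟨e2, hB2⟩)
      exact absurd heq (pair_ne_of_ne h02.symm h12.symm)
    · -- two non-bond edges `{w 0, w 1}`, `{w 1, w 2}`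
      have heq := Finset.card_le_one.1 hfilt {w 0, w 1} (by rw [Finset.mem_filter]; exact ⟨e0, hB0⟩)
        {w 1, w 2} (by rw [Finset.mem_filter]; exact ⟨e1, hB1⟩)
      exact absurd heq (pair_ne_of_ne_left h01 h02)
    · -- three non-bond edges
      have heq := Finset.card_le_one.1 hfilt {w 0, w 1} (by rw [Finset.mem_filter]; exact ⟨e0, hB0⟩)
        {w 1, w 2} (by rw [Finset.mem_filter]; exact ⟨e1, hB1⟩)
      exact absurd heq (pair_ne_of_ne_left h01 h02)
  · ----------------------------------------------------------------- quadrilaterals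
    have hm4' : (facetAngles X c hc0).card = 4 := by rw [hm, hm4]
    rw [hm4'] at hedges
    have hedge : ∀ j < 4, ({w j, w ((j + 1) % 4)} : Finset (EuclideanSpace ℝ (Fin 3))) ∈ edgesOfFacet X c := by
      intro j hj; rw [hedges]; exact Finset.mem_image.2 ⟨j, Finset.mem_range.2 hj, rfl⟩
    have hall : ∀ T ∈ edgesOfFacet X c, T ∈ B := by
      intro T hTe
      by_contra hTB
      have hpos : 0 < ((edgesOfFacet X c).filter (fun T => T ∉ B)).card :=
        Finset.card_pos.2 ⟨T, by rw [Finset.mem_filter]; exact ⟨hTe, hTB⟩⟩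
      omega
    have l0 : 0 < (tightSet X c).card := by omega
    have l1 : 1 < (tightSet X c).card := by omega
    have l2 : 2 < (tightSet X c).card := by omega
    have l3 : 3 < (tightSet X c).card := by omega
    have e0 := hall _ (hedge 0 (by norm_num))
    have e1 := hall _ (hedge 1 (by norm_num))
    have e2 := hall _ (hedge 2 (by norm_num))
    have e3 := hall _ (hedge 3 (by norm_num))
    simp only [Nat.reduceAdd, Nat.reduceMod] at e0 e1 e2 e3
    have hg0 := gap_window (g := φ 1 - φ 0) hρ2 (by linarith [hφlt 0 1 zero_lt_one l1])
      (hφ2π 1 0) (hsepw 0 1 l0 l1 (by norm_num))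
    have hg1 := gap_window (g := φ 2 - φ 1) hρ2 (by linarith [hφlt 1 2 one_lt_two l2])
      (hφ2π 2 1) (hsepw 1 2 l1 l2 (by norm_num))
    have hg2 := gap_window (g := φ 3 - φ 2) hρ2 (by linarith [hφlt 2 3 (by norm_num) l3])
      (hφ2π 3 2) (hsepw 2 3 l2 l3 (by norm_num))
    have hsep30 : ρ ^ 2 * Real.cos (2 * π - (φ 3 - φ 0)) + κ ^ 2 ≤
        1 - 1 / (2 * (101 / 100 : ℝ) ^ 2) := by
      rw [Real.cos_two_pi_sub]; exact hsepw 0 3 l0 l3 (by norm_num)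
    have hg3 := gap_window (g := 2 * π - (φ 3 - φ 0)) hρ2 (by linarith [hφ2π 3 0])
      (by linarith [hφlt 0 3 (by norm_num) l3]) hsep30
    have hb0 := bond_gap hlt (hbondw 0 1 l0 l1 e0)
    have hb1 := bond_gap hlt (hbondw 1 2 l1 l2 e1)
    have hb2 := bond_gap hlt (hbondw 2 3 l2 l3 e2)
    have hb3 : 2 * π - (φ 3 - φ 0) < π / 2 ∨ 3 * π / 2 < 2 * π - (φ 3 - φ 0) := by
      have h' := hbond_pair _ _ e3
      rw [hinner 3 0 l3 l0] at h'
      rw [← Real.cos_two_pi_sub] at h'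
      exact bond_gap hlt h'
    have hsum : (φ 1 - φ 0) + (φ 2 - φ 1) + (φ 3 - φ 2) + (2 * π - (φ 3 - φ 0)) = 2 * π := by
      ring
    exact four_gaps_false hsum hg0.1 hg1.1 hg2.1 hg3.1 hb0 hb1 hb2 hb3

end Summit.AtomisticToContinuum.Crystallization.Theorems.OverbindingBudgetShellHoleFacets
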